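import Mathlib
import HarnessLib
import Literature.Analysis.FluidPDE.Tao2016AveragedNS.TaylorChainCertificate
import Literature.Analysis.ODE.StepChain
import Literature.Analysis.ODE.GlobalExistence
import Summits.NavierStokesRegularity.NavierStokesRegularity.Theorems.TaylorModelRungThreeReadoutChainLevels
import Summits.NavierStokesRegularity.NavierStokesRegularity.Theorems.TaylorModelRungThreeReadoutG2Sigma

/-!
# Line `taylor-model` on crux K1b-DR (stmt-NavierStokesRegularity-23954) — stub G1 (`ChainEnclosureHolds`),
# helper 4: gluing the node steps along the mesh — clauses C1–C3 of `ChainEnclosure`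

Window-coordinate solutions versus the package selector: a solution `y : ℝ → (Fin (nW cd) → ℝ)` of the
transported ODE `x' = Qw x x` on `[0, T]` from `toVec q` IS the selector `φ j q` there (package uniqueness F2),
so the selector solves on `[0, T]` (`solvesOn_of_vecSolution`); hence the FLOW PROPERTY
`stAt φ j q (t + u) = stAt φ j (stAt φ j q t) u` (`stAt_add`) and APPENDING (`solvesOn_append`, via
`Literature.Analysis.ODE.solution_append`). The node steps of helper 3 are then chained along the mesh from any
node `s₀` with the abstract validated-step chain `Literature.Analysis.ODE.exists_solution_of_stepChain` run in
window coordinates (admissible sets `{x | Nd s (ofVec x)}`, enclosure relation "`w` is the package flow of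
`x`"): `chain_glue_from` — for a generic window-only node predicate carried node to node; specialised to `NodeE`
(every entry state of the polytope) and `NodeI` (the base trajectory from `x j 0`) from `s₀ = 0` it yields
clauses C1–C3 of `ChainEnclosure` verbatim (`chain_C123`).

MODEL-lattice bookkeeping only (rung TL-M3); nothing here is a statement about the Navier–Stokes equations.
-/

noncomputable section

-- the sub-problem namespace repeats the summit name by design (D-0017)
set_option linter.dupNamespace false

namespace Summit.NavierStokesRegularity.NavierStokesRegularity.Theorems.TaylorModelReadout

open scoped BigOperators
open Set Finset Literature.Analysis.FluidPDE.TaoCascade Literature.Analysis.FluidPDE.TaoCascade.TaylorChain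

variable {cd : CertData} {φ : Flow}

/-! ### Window-coordinate trajectories -/

/-- The window-coordinate trajectory `u ↦ toVec (stAt φ j y u)` of a flow solving K1b-DR's ODE clause on
`[0, T]` solves the transported ODE `x' = Qw x x` there. [folklore] -/
theorem hasDerivWithinAt_toVec_stAt {j : ℕ} {y : Fin 4 → ℤ → ℝ} {T : ℝ} (hsol : SolvesOn cd φ j y T) {u : ℝ}
    (hu : u ∈ Icc 0 T) :
    HasDerivWithinAt (fun u => toVec cd (stAt φ j y u))
      (Qw cd (toVec cd (stAt φ j y u)) (toVec cd (stAt φ j y u))) (Icc 0 T) u := by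
  refine hasDerivWithinAt_pi.2 fun c => ?_
  have hk := shellOf_mem cd c
  have h1 := (hsol (modeOf cd c) (shellOf cd c) hk.1 hk.2).2 u hu
  rw [quadTerm_trunc_eq_qT (cd := cd) _ _ hk, qT_eq_Qw_apply (cd := cd) _ _ hk] at h1
  have hc : eW cd (modeOf cd c, ⟨shellOf cd c, Finset.mem_Icc.2 hk⟩) = c := Equiv.apply_symm_apply (eW cd) c
  rw [hc] at h1
  exact h1

/-- At time `0` a solving flow sits at (the window part of) its datum. [folklore] -/
theorem toVec_stAt_zero {j : ℕ} {y : Fin 4 → ℤ → ℝ} {T : ℝ} (hsol : SolvesOn cd φ j y T) :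
    toVec cd (stAt φ j y 0) = toVec cd y := by
  funext c
  have hk := shellOf_mem cd c
  exact (hsol (modeOf cd c) (shellOf cd c) hk.1 hk.2).1

/-- Shifting a solution of an autonomous ODE within closed intervals: if `g` has derivative `g'` within
`[a, b]` at `c + x` then `x ↦ g (c + x)` has derivative `g'` within `[a - c, b - c]` at `x`. [folklore] -/
theorem hasDerivWithinAt_comp_const_add {g : ℝ → Fin (nW cd) → ℝ} {g' : Fin (nW cd) → ℝ} {a b c x : ℝ}
    (h : HasDerivWithinAt g g' (Icc a b) (c + x)) :
    HasDerivWithinAt (fun x => g (c + x)) g' (Icc (a - c) (b - c)) x := by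
  have h1 : HasDerivWithinAt (fun x : ℝ => c + x) 1 (Icc (a - c) (b - c)) x :=
    (hasDerivWithinAt_id x _).const_add c
  have h2 := h.scomp x h1 (fun y hy => ⟨by linarith [hy.1], by linarith [hy.2]⟩)
  rw [one_smul] at h2
  exact h2

section Sel

variable (hF : IsFlowPackage cd φ) {j : ℕ} (hj : j ≤ cd.N₀)
include hF hj

/-- **A window solution is the selector.** If `y` solves `x' = Qw x x` on `[0, T]` from `toVec q`, then the
selector `φ j q` solves K1b-DR's ODE clause on `[0, T]` and `ofVec (y t) = stAt φ j q t` there (F2 + F0). [folklore] -/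
theorem solvesOn_of_vecSolution {q : Fin 4 → ℤ → ℝ} {T : ℝ} (hT : 0 ≤ T) {y : ℝ → Fin (nW cd) → ℝ}
    (hy0 : y 0 = toVec cd q) (hyd : ∀ t ∈ Icc 0 T, HasDerivWithinAt y (Qw cd (y t) (y t)) (Icc 0 T) t) :
    SolvesOn cd φ j q T ∧ ∀ t ∈ Icc 0 T, ofVec cd (y t) = stAt φ j q t := by
  have hψ : ∀ i k, -cd.Kb ≤ k → k ≤ cd.Ka → (fun t => ofVec cd (y t) i k) 0 = q i k ∧
      ∀ t' ∈ Icc 0 T, HasDerivWithinAt (fun t => ofVec cd (y t) i k)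
        (quadTerm 1 cd.α (fun j' n s' => if -cd.Kb ≤ n ∧ n ≤ cd.Ka then (fun t => ofVec cd (y t) j' n) s' else 0)
          i k t') (Icc 0 T) t' := by
    intro i k hk1 hk2
    have hk : -cd.Kb ≤ k ∧ k ≤ cd.Ka := ⟨hk1, hk2⟩
    refine ⟨?_, fun t' ht' => ?_⟩
    · show ofVec cd (y 0) i k = q i k
      rw [hy0, ofVec_toVec, trunc_apply, if_pos hk]
    · rw [quadTerm_trunc_eq_qT (cd := cd) _ _ hk, qT_eq_Qw_apply (cd := cd) _ _ hk]
      have h1 := (hasDerivWithinAt_pi.1 (hyd t' ht')) (eW cd (i, ⟨k, Finset.mem_Icc.2 hk⟩))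
      have h2 : (fun t => ofVec cd (y t) i k) = fun t => y t (eW cd (i, ⟨k, Finset.mem_Icc.2 hk⟩)) := by
        funext t; exact ofVec_apply_of_mem cd (y t) i hk
      rw [h2]
      have h3 : toVec cd (fun j' n => ofVec cd (y t') j' n) = y t' := toVec_ofVec cd (y t')
      rw [h3]
      exact h1
  have hident := (hF j hj).2.2.1 q T (fun i k t => ofVec cd (y t) i k) hT hψ
  have hst : ∀ t ∈ Icc 0 T, ofVec cd (y t) = stAt φ j q t := by
    intro t ht
    funext i k
    by_cases hk : -cd.Kb ≤ k ∧ k ≤ cd.Ka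
    · exact hident i k hk.1 hk.2 t ht
    · rw [ofVec_apply_of_not_mem cd _ i hk]
      exact ((hF j hj).1 q i k hk t).symm
  refine ⟨fun i k hk1 hk2 => ⟨?_, fun t' ht' => ?_⟩, hst⟩
  · rw [← hident i k hk1 hk2 0 ⟨le_rfl, hT⟩]
    exact (hψ i k hk1 hk2).1
  · have hk : -cd.Kb ≤ k ∧ k ≤ cd.Ka := ⟨hk1, hk2⟩
    have h1 := (hψ i k hk1 hk2).2 t' ht'
    rw [quadTerm_trunc_eq_qT (cd := cd) _ _ hk] at h1 ⊢
    have h2 : (fun j' n => (fun t => ofVec cd (y t) j' n) t') = stAt φ j q t' := by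
      show (fun j' n => ofVec cd (y t') j' n) = stAt φ j q t'
      exact hst t' ht'
    rw [h2] at h1
    exact h1.congr_of_mem (fun t ht => by
      show φ j q i k t = ofVec cd (y t) i k
      exact (hident i k hk1 hk2 t ht).symm) ht'

/-- **Flow property of the selector.** If `φ j q` solves on `[0, T]` and `t ∈ [0, T]`, then `φ j (stAt φ j q t)`
solves on `[0, T - t]` and `stAt φ j q (t + u) = stAt φ j (stAt φ j q t) u` for `u ∈ [0, T - t]`. [folklore] -/
theorem stAt_add {q : Fin 4 → ℤ → ℝ} {T : ℝ} (hsol : SolvesOn cd φ j q T) {t : ℝ} (ht : t ∈ Icc 0 T) :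
    SolvesOn cd φ j (stAt φ j q t) (T - t) ∧
      ∀ u ∈ Icc 0 (T - t), stAt φ j q (t + u) = stAt φ j (stAt φ j q t) u := by
  have hT : 0 ≤ T - t := sub_nonneg.2 ht.2
  have hy0 : (fun u => toVec cd (stAt φ j q (t + u))) 0 = toVec cd (stAt φ j q t) := by
    show toVec cd (stAt φ j q (t + 0)) = toVec cd (stAt φ j q t)
    rw [add_zero]
  have hyd : ∀ u ∈ Icc 0 (T - t), HasDerivWithinAt (fun u => toVec cd (stAt φ j q (t + u)))
      (Qw cd (toVec cd (stAt φ j q (t + u))) (toVec cd (stAt φ j q (t + u)))) (Icc 0 (T - t)) u := by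
    intro u hu
    have h1 := hasDerivWithinAt_toVec_stAt hsol (u := t + u) ⟨by linarith [ht.1, hu.1], by linarith [hu.2]⟩
    have h2 := hasDerivWithinAt_comp_const_add (c := t) (x := u) h1
    rw [zero_sub] at h2
    exact h2.mono (fun y hy => ⟨by linarith [hy.1, ht.1], hy.2⟩)
  obtain ⟨hs, hid⟩ := solvesOn_of_vecSolution hF hj hT hy0 hyd
  refine ⟨hs, fun u hu => ?_⟩
  rw [← hid u hu, ofVec_toVec_of_wsupp cd (stAt_off_window hF hj _ _)]

/-- **Appending.** If `φ j z` solves on `[0, T₁]` and `φ j (stAt φ j z T₁)` solves on `[0, T₂]`, then `φ j z`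
solves on `[0, T₁ + T₂]` and `stAt φ j z (T₁ + u) = stAt φ j (stAt φ j z T₁) u` on `[0, T₂]`. [folklore] -/
theorem solvesOn_append {z : Fin 4 → ℤ → ℝ} {T₁ T₂ : ℝ} (hT₁ : 0 ≤ T₁) (hT₂ : 0 ≤ T₂)
    (h1 : SolvesOn cd φ j z T₁) (h2 : SolvesOn cd φ j (stAt φ j z T₁) T₂) :
    SolvesOn cd φ j z (T₁ + T₂) ∧
      ∀ u ∈ Icc 0 T₂, stAt φ j z (T₁ + u) = stAt φ j (stAt φ j z T₁) u := by
  -- the two window-coordinate pieces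
  obtain ⟨α, hαd⟩ : ∃ α : ℝ → Fin (nW cd) → ℝ, α = fun u => toVec cd (stAt φ j z u) := ⟨_, rfl⟩
  obtain ⟨β, hβd⟩ : ∃ β : ℝ → Fin (nW cd) → ℝ,
      β = fun u => toVec cd (stAt φ j (stAt φ j z T₁) (-T₁ + u)) := ⟨_, rfl⟩
  have hα : ∀ t ∈ Icc 0 T₁, HasDerivWithinAt α ((fun (_ : ℝ) (x : Fin (nW cd) → ℝ) => Qw cd x x) t (α t))
      (Icc 0 T₁) t := by
    intro t ht
    rw [hαd]
    exact hasDerivWithinAt_toVec_stAt h1 ht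
  have hβ : ∀ t ∈ Icc T₁ (T₁ + T₂), HasDerivWithinAt β ((fun (_ : ℝ) (x : Fin (nW cd) → ℝ) => Qw cd x x) t (β t))
      (Icc T₁ (T₁ + T₂)) t := by
    intro t ht
    have h3 := hasDerivWithinAt_toVec_stAt h2 (u := -T₁ + t) ⟨by linarith [ht.1], by linarith [ht.2]⟩
    have h4 := hasDerivWithinAt_comp_const_add (c := -T₁) (x := t) h3
    have e1 : (0 : ℝ) - -T₁ = T₁ := by ring
    have e2 : T₂ - -T₁ = T₁ + T₂ := by ring
    rw [e1, e2] at h4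
    rw [hβd]
    exact h4
  have hjoin : α T₁ = β T₁ := by
    rw [hαd, hβd]
    show toVec cd (stAt φ j z T₁) = toVec cd (stAt φ j (stAt φ j z T₁) (-T₁ + T₁))
    rw [neg_add_cancel, toVec_stAt_zero h2]
  have happ := Literature.Analysis.ODE.solution_append (v := fun (_ : ℝ) (x : Fin (nW cd) → ℝ) => Qw cd x x)
    hα hβ hT₁ (le_add_of_nonneg_right hT₂) hjoin
  -- the glued window solution from `toVec z`
  obtain ⟨w, hwd'⟩ : ∃ w : ℝ → Fin (nW cd) → ℝ, w = fun s => if s ≤ T₁ then α s else β s := ⟨_, rfl⟩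
  have hwd : ∀ t ∈ Icc 0 (T₁ + T₂), HasDerivWithinAt w (Qw cd (w t) (w t)) (Icc 0 (T₁ + T₂)) t := by
    intro t ht
    rw [hwd']
    exact happ t ht
  have hw0 : w 0 = toVec cd z := by
    rw [hwd']
    show (if (0 : ℝ) ≤ T₁ then α 0 else β 0) = toVec cd z
    rw [if_pos hT₁, hαd]
    exact toVec_stAt_zero h1
  obtain ⟨hs, hid⟩ := solvesOn_of_vecSolution hF hj (by linarith) hw0 hwd
  refine ⟨hs, fun u hu => ?_⟩
  have h5 := hid (T₁ + u) ⟨by linarith [hu.1], by linarith [hu.2]⟩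
  have h6 : w (T₁ + u) = toVec cd (stAt φ j (stAt φ j z T₁) u) := by
    rw [hwd']
    show (if T₁ + u ≤ T₁ then α (T₁ + u) else β (T₁ + u)) = toVec cd (stAt φ j (stAt φ j z T₁) u)
    by_cases hle : T₁ + u ≤ T₁
    · have hu0 : u = 0 := le_antisymm (by linarith) hu.1
      rw [if_pos hle, hαd, hu0, add_zero]
      exact (toVec_stAt_zero h2).symm
    · rw [if_neg hle, hβd]
      show toVec cd (stAt φ j (stAt φ j z T₁) (-T₁ + (T₁ + u))) = toVec cd (stAt φ j (stAt φ j z T₁) u)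
      rw [neg_add_cancel_left]
  rw [h6, ofVec_toVec_of_wsupp cd (stAt_off_window hF hj _ _)] at h5
  exact h5.symm

end Sel

section Glue

variable (hF : IsFlowPackage cd φ) (hV : cd.Valid) {j : ℕ} (hj : j ≤ cd.N₀)
include hF hV hj

/-- **Gluing lemma (generic level, from node `s₀`).** Let `Nd s` be a window-only node predicate whose states lie
in the window ball `mC j s + ρO j s` and which the package flow carries from node `s` to node `s+1` over
`h j s` with the in-step enclosure `TP j s u + Ball(R s)`. Then from every `y` with `Nd s₀ y`: the selector
`φ j y` solves on `[0, Tn j (S j) - Tn j s₀]`, is an `Nd s` state at every later node (relative time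
`Tn j s - Tn j s₀`), and obeys the in-step enclosures. [cite: Zgliczynski2002C1Lohner, §3–4] -/
theorem chain_glue_from (Nd : ℕ → (Fin 4 → ℤ → ℝ) → Prop) (R : ℕ → ℝ)
    (hwin : ∀ s (y y' : Fin 4 → ℤ → ℝ), (∀ i k, -cd.Kb ≤ k → k ≤ cd.Ka → y i k = y' i k) → Nd s y → Nd s y')
    (hball : ∀ s, s ≤ cd.S j → ∀ y, Nd s y → cd.InBall j y (cd.mC j s + cd.ρO j s))
    (hstep : ∀ s, s < cd.S j → ∀ y, Nd s y → Nd (s + 1) (stAt φ j y (cd.h j s)) ∧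
      ∀ u ∈ Icc 0 (cd.h j s), cd.InBall j (stAt φ j y u - cd.TP j s u) (R s))
    {s₀ : ℕ} (hs₀ : s₀ ≤ cd.S j) {y : Fin 4 → ℤ → ℝ} (hy : Nd s₀ y) :
    SolvesOn cd φ j y (cd.Tn j (cd.S j) - cd.Tn j s₀) ∧
    (∀ s, s₀ ≤ s → s ≤ cd.S j → Nd s (stAt φ j y (cd.Tn j s - cd.Tn j s₀))) ∧
      ∀ s, s₀ ≤ s → s < cd.S j → ∀ u ∈ Icc 0 (cd.h j s),
        cd.InBall j (stAt φ j y (cd.Tn j s - cd.Tn j s₀ + u) - cd.TP j s u) (R s) := by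
  have hCh := hV.2.2.1
  -- sub-step solutions from node states (F1 under the guard `bb (mC + ρO) h < 1`)
  have hsolstep : ∀ s, s < cd.S j → ∀ y, Nd s y → SolvesOn cd φ j y (cd.h j s) := by
    intro s hs y hy
    obtain ⟨-, -, a3, -, -, a6, a7, a8, a9, -⟩ := (hCh j hj).2.2.2.2.2.2.1 s hs.le
    obtain ⟨b1, -, b3, -⟩ := (hCh j hj).2.2.2.2.2.2.2 s hs
    have hm : 0 ≤ cd.mC j s + cd.ρO j s := by linarith
    exact ((hF j hj).2.1 y _ _ hm (hball s hs.le y hy) b1.le b3).1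
  -- the relative mesh from node `s₀`
  obtain ⟨τ, hτ⟩ : ∃ τ : ℕ → ℝ, ∀ s, τ s = cd.Tn j (s₀ + s) - cd.Tn j s₀ := ⟨_, fun _ => rfl⟩
  have hτ0 : τ 0 = 0 := by rw [hτ, add_zero, sub_self]
  have hτd : ∀ s, s < cd.S j - s₀ → τ (s + 1) - τ s = cd.h j (s₀ + s) := fun s hs => by
    rw [hτ, hτ, show s₀ + (s + 1) = s₀ + s + 1 from rfl, G2.valid_Tn_succ hV hj (by omega)]
    ring
  have hτm : ∀ s, s < cd.S j - s₀ → τ s ≤ τ (s + 1) := fun s hs => by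
    have h1 := hτd s hs
    have h2 := ((hCh j hj).2.2.2.2.2.2.2 (s₀ + s) (by omega)).1
    linarith
  -- the abstract chain in window coordinates
  obtain ⟨w, hw0, hwd, hwW, hwQ⟩ := Literature.Analysis.ODE.exists_solution_of_stepChain
    (f := fun x => Qw cd x x) (τ := τ) (W := fun s => {x | Nd (s₀ + s) (ofVec cd x)})
    (Q := fun _ u x w => w = toVec cd (stAt φ j (ofVec cd x) u)) (cd.S j - s₀) hτ0 hτm
    (fun s hs x hx => by
      refine ⟨fun u => toVec cd (stAt φ j (ofVec cd x) u), ?_, fun u hu => ?_, fun u _ => rfl⟩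
      · show toVec cd (stAt φ j (ofVec cd x) 0) = x
        rw [toVec_stAt_zero (hsolstep (s₀ + s) (by omega) _ hx), toVec_ofVec]
      · rw [hτd s hs] at hu ⊢
        exact hasDerivWithinAt_toVec_stAt (hsolstep (s₀ + s) (by omega) _ hx) hu)
    (fun s hs x hx w hw => by
      show Nd (s₀ + (s + 1)) (ofVec cd w)
      have hw' : w = toVec cd (stAt φ j (ofVec cd x) (cd.h j (s₀ + s))) := by rw [hw, hτd s hs]
      rw [hw', ofVec_toVec_of_wsupp cd (stAt_off_window hF hj _ _)]
      exact (hstep (s₀ + s) (by omega) _ hx).1)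
    (y₀ := toVec cd y) (by
      show Nd (s₀ + 0) (ofVec cd (toVec cd y))
      rw [add_zero, ofVec_toVec]
      exact hwin s₀ y _ (fun i k h1 h2 => by simp [trunc, h1, h2]) hy)
  -- identification with the selector on `[0, Tn S - Tn s₀]`
  have hN : τ (cd.S j - s₀) = cd.Tn j (cd.S j) - cd.Tn j s₀ := by rw [hτ, Nat.add_sub_cancel' hs₀]
  rw [hN] at hwd
  have hT : 0 ≤ cd.Tn j (cd.S j) - cd.Tn j s₀ := sub_nonneg.2 (G2.Tn_mono hCh hj hs₀ le_rfl)
  obtain ⟨hsol, hid⟩ := solvesOn_of_vecSolution hF hj hT hw0 hwd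
  refine ⟨hsol, fun s hs1 hs2 => ?_, fun s hs1 hs2 u hu => ?_⟩
  · -- node predicate at the nodes
    have h1 : Nd (s₀ + (s - s₀)) (ofVec cd (w (τ (s - s₀)))) := hwW (s - s₀) (by omega)
    have h2 : τ (s - s₀) = cd.Tn j s - cd.Tn j s₀ := by rw [hτ, Nat.add_sub_cancel' hs1]
    rw [Nat.add_sub_cancel' hs1, h2, hid _ ⟨sub_nonneg.2 (G2.Tn_mono hCh hj hs1 hs2),
      sub_le_sub_right (G2.Tn_mono hCh hj hs2 le_rfl) _⟩] at h1
    exact h1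
  · -- in-step enclosures
    have hys : Nd (s₀ + (s - s₀)) (ofVec cd (w (τ (s - s₀)))) := hwW (s - s₀) (by omega)
    have h2 : τ (s - s₀) = cd.Tn j s - cd.Tn j s₀ := by rw [hτ, Nat.add_sub_cancel' hs1]
    have h3 : τ (s - s₀ + 1) = cd.Tn j (s + 1) - cd.Tn j s₀ := by
      rw [hτ, show s₀ + (s - s₀ + 1) = s + 1 by omega]
    have ht1 : τ (s - s₀) ≤ cd.Tn j s - cd.Tn j s₀ + u := by rw [h2]; linarith [hu.1]
    have ht2 : cd.Tn j s - cd.Tn j s₀ + u ≤ τ (s - s₀ + 1) := by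
      rw [h3, G2.valid_Tn_succ hV hj hs2]; linarith [hu.2]
    have hQ := hwQ (s - s₀) (by omega) (cd.Tn j s - cd.Tn j s₀ + u) ⟨ht1, ht2⟩
    rw [h2, add_sub_cancel_left] at hQ
    rw [Nat.add_sub_cancel' hs1, h2] at hys
    have hmem : cd.Tn j s - cd.Tn j s₀ + u ∈ Icc 0 (cd.Tn j (cd.S j) - cd.Tn j s₀) := by
      refine ⟨by linarith [sub_nonneg.2 (G2.Tn_mono hCh hj hs1 hs2.le), hu.1], ?_⟩
      have := G2.Tn_mono hCh hj (Nat.succ_le_of_lt hs2) le_rfl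
      rw [G2.valid_Tn_succ hV hj hs2] at this
      linarith [hu.2]
    have h4 : stAt φ j y (cd.Tn j s - cd.Tn j s₀ + u) = stAt φ j (ofVec cd (w (cd.Tn j s - cd.Tn j s₀))) u := by
      rw [← hid _ hmem, hQ, ofVec_toVec_of_wsupp cd (stAt_off_window hF hj _ _)]
    rw [h4]
    exact (hstep s hs2 _ hys).2 u hu

/-- **Clauses C1–C3 of `ChainEnclosure`** for every entry state of the polytope: the selector solves on the
stage horizon; node invariant at level `E` (level `EI` for the base trajectory `q = x j 0`); in-step
enclosures `Sp` (`SpI`). [cite: Zgliczynski2002C1Lohner, §3–4] -/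
theorem chain_C123 {q : Fin 4 → ℤ → ℝ} (hq : InPoly cd j q) :
    SolvesOn cd φ j q (cd.Tn j (cd.S j)) ∧
    (∀ s', s' ≤ cd.S j → ∃ ξ e : (Fin 4 → ℤ → ℝ),
      (∀ i k, -cd.Kb ≤ k → k ≤ cd.Ka → |ξ i k| ≤ cd.rP j s' i k ∧
        φ j q i k (cd.Tn j s') = cd.x j s' i k + cd.Cm j s' ξ i k + e i k) ∧
      cd.InBall j e (cd.E j s') ∧ (q = cd.x j 0 → cd.InBall j e (cd.EI j s'))) ∧
    (∀ s', s' < cd.S j → ∀ u ∈ Icc 0 (cd.h j s'),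
      cd.InBall j (stAt φ j q (cd.Tn j s' + u) - cd.TP j s' u) (cd.Sp j s') ∧
      (q = cd.x j 0 → cd.InBall j (stAt φ j q (cd.Tn j s' + u) - cd.TP j s' u) (cd.SpI j s'))) := by
  have h0 : cd.Tn j 0 = 0 := (hV.2.2.1 j hj).2.1
  -- level E run from `q`
  obtain ⟨hC1, hNE, hSE⟩ := chain_glue_from hF hV hj (NodeE cd j) (cd.Sp j)
    (fun s y y' hyy h => h.congr hyy) (fun s hs y h => h.inBall hV hj hs)
    (fun s hs y h => nodeE_step hF hV hj hs h) (Nat.zero_le _) (nodeE_zero hV hj hq)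
  -- level EI run from `x j 0`
  obtain ⟨-, hNI, hSI⟩ := chain_glue_from hF hV hj (NodeI cd j) (cd.SpI j)
    (fun s y y' hyy h => h.congr hyy) (fun s hs y h => (h.nodeE hV hj hs).inBall hV hj hs)
    (fun s hs y h => nodeI_step hF hV hj hs h) (Nat.zero_le _) (nodeI_zero hV hj)
  simp only [h0, sub_zero] at hC1 hNE hSE hNI hSI
  refine ⟨hC1, fun s' hs' => ?_, fun s' hs' u hu => ⟨hSE s' (Nat.zero_le _) hs' u hu, fun hq0 => ?_⟩⟩
  · by_cases hq0 : q = cd.x j 0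
    · obtain ⟨ξ, e, hd, hE, hEI⟩ := (hNI s' (Nat.zero_le _) hs').decomp hV hj hs'
      rw [← hq0] at hd
      exact ⟨ξ, e, hd, hE, fun _ => hEI⟩
    · obtain ⟨ξ, e, hd, hE⟩ := hNE s' (Nat.zero_le _) hs'
      exact ⟨ξ, e, hd, hE, fun h => absurd h hq0⟩
  · rw [hq0]
    exact hSI s' (Nat.zero_le _) hs' u hu

end Glue

end Summit.NavierStokesRegularity.NavierStokesRegularity.Theorems.TaylorModelReadout

end
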